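import Summits.BirchSwinnertonDyer.BirchSwinnertonDyer.Theorems.PrintCFramBottomClassIndexLawFiveLeBorelOrderTelescopePerStep
import HarnessLib

/-!
# Route `PrintCFram`, crux C2 `BottomClassIndexLawFiveLe` (stmt-BirchSwinnertonDyer-20372), line
# `eisenstein-resource-bdp-line` (registry v32), road II UPPER (Kolyvagin at the Borel CM-ramified prime):
# **KOLYVAGIN'S ORDER TELESCOPE, IV — THE TWO FROBENIUS TYPES: `Σ Nⱼ ≤ M₀ + Σ δ(sⱼ)` AND
# `Σ ⌈dp sⱼ/2⌉ ≤ M₀ + #{j : dp sⱼ odd}`** (sequel of `…BorelOrderTelescopePerStep`; cell `bsd-print-cfram`, width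
# seat `bsd-line-cfram-p1-w8` g17; helper `--supports` 20372; 0 defs, 0 facts, 0 sorry)

HONEST FRAMING. Nothing about BSD is proved here and nothing of any stub; pure algebra. File III
(`…BorelOrderTelescopePerStep`) runs McCallum's chain (Thm. 5.4) with a per-step defect budget `D : ℕ → ℕ` and a
kernel-form Čebotarev supplier that receives the step index `j` and returns its own split `d₁ + d₂ ≤ D j` of the
step's budget between the lift `s_j` (sign `ν`) and the Kolyvagin class `c(n_{j−1})` (sign `−ν`); ledger
`Σ_{j≤K} expo s_j ≤ M₀ + Σ_{j≤K} D j`. This file draws the conclusions: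

* §3 `stepDefect_of_signDefect` — the sign-keyed axiom `hCebΔ` of files I/II (w2 g8) IS a per-step supplier with the
  constant budget `D ≡ Δ1 + Δ(−1)`; `sum_expo_le_M₀_add_mul_of_signDefect` re-derives file II's ledger
  `Σ Nⱼ ≤ M₀ + K·(Δ1+Δ(−1))` from file III (conservativity).
* §4 `stepDefect_of_twoTypes` — w5 g12's observation, booked: with `η = ±1` the line sign and `δ : V → ℕ` a
  displayed defect function, a TYPE-ONE supplier (Gross (3.2) `[c₀]`-primes: defect `δ g` on the step's class of
  sign `−η`, none on the class of sign `η`) together with a TYPE-TWO supplier (`[c₀ z]`-primes, `z` acting as `−1`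
  on `W[p^M]`: defect `δ g` on the class of sign `η`, none on the other) yield the per-step supplier with budget
  **`D j = δ (s j)`** — at each step take the type that sees the Kolyvagin class at full order and pay on the lift;
  `sum_expo_le_M₀_add_sum_defect_of_twoTypes` — **`Σ_{j≤K} expo s_j ≤ M₀ + Σ_{j≤K} δ(s_j)`**: the slack over
  McCallum's `M₀` is the total defect of the LIFTS (a quantity of the data), not one unit per step.
* §5 `sum_half_succ_dp_le_M₀_add_card_odd_of_twoTypes` — in the `𝓞`-depth currency of `…BorelDescentClaimA`
  (`p^a v = 0 ↔ dp v ≤ 2a`, `ord v = p^{⌈dp v/2⌉}`, defect `dp mod 2` = what a prime of the disfavouring type loses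
  on a class of odd depth): **`Σ_{j≤K} ⌈dp s_j/2⌉ ≤ M₀ + #{j ≤ K : dp s_j odd}`**;
  `sum_half_succ_dp_le_M₀_of_twoTypes_of_even` — all lifts of even depth ⟹ **`Σ ⌈dp s_j/2⌉ ≤ M₀`**, McCallum's
  inequality (hence `#Ш_{p^∞} ≤ p^{2M₀}`, Cor. 5.6) VERBATIM.
READING for the class (numbers, not adjectives; nothing of it is claimed in the kernel): for a proper twist
`W = A(p)^{(e)}` and a Heegner field `K″` with `K(√d″) ≠ K(√e)` both types exist (w5 g12 §2, by hand), so once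
the two REQUEST-form suppliers are typed (FILE 7′ `…BorelRequestsCebotarev` at type one, its sign-swapped twin
at type two, plus the top-layer reduction of the later lifts — w5 g12's typing debt (i)–(iii), NOT done here) the
order bound reads `ord_p #Ш(W/K″)[p^∞] ≤ 2M₀ + 2·#{odd-depth lifts}`; for the untwisted `A(p)` only type one exists
and files I/II (`2M₀ + 2K`) remain the statement. Whether the lifts of a maximal isotropic subgroup can be taken
of even `𝓞`-depth is the research residue; UPPER is NOT claimed. THEOREMS ONLY; no definition, no named fact, no
`sorry`. BSD is not proved by any of this; no summit statement is proved by this seat.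
References: [McCallumLMS1991] §1 Theorem, §3 Prop. 3.1/Cor. 3.2, Prop. 4.7, Lemma 5.3, Thm. 5.4, Cor. 5.6;
[GrossLMS1991] §3 (3.1)–(3.3).
-/

set_option autoImplicit false
-- `…BirchSwinnertonDyer.BirchSwinnertonDyer.Theorems…` is the problem's mandated namespace (D-0017).
set_option linter.dupNamespace false

noncomputable section

open scoped Classical

namespace Summit.BirchSwinnertonDyer.BirchSwinnertonDyer.Theorems.PrintCFram.BorelDescent

open Literature.NumberTheory.EllipticCurves Literature.NumberTheory.EllipticCurves.KolyvaginDescent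
  Summit.BirchSwinnertonDyer.BirchSwinnertonDyer.Theorems.SylvesterTwoUpper.DescentDefect

/-! ## §3 Conservativity: the sign-keyed axiom of files I/II is the constant budget `D ≡ Δ1 + Δ(−1)` -/

section SignDefect

variable {V : Type*} [AddCommGroup V] {Pl : Type*}
variable {p M M₀ M₁ : ℕ} {ε : ℤ} {τ : V →+ V} {Sel : AddSubgroup V} {Loc : Pl → AddSubgroup V}
  {Kol : ℕ → Prop} {pl : ℕ → Pl} {A : ℕ → AddSubgroup V} {x : V} {c : ℕ → V}
  {expo : V → ℕ} {Δ : ℤ → ℕ} {K : ℕ} {s : ℕ → V}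

/-- **The sign-keyed kernel-form Čebotarev `hCebΔ` of files I/II is a per-step supplier with the constant budget
`D j = Δ1 + Δ(−1)`** (split `d₁ = Δ ν`, `d₂ = Δ(−ν)` at a step of sign `ν`). [folklore] -/
theorem stepDefect_of_signDefect
    (hCebΔ : ∀ (T : Finset V) (g₁ g₂ : V) (ν : ℤ), (ν = 1 ∨ ν = -1) → τ g₁ = ν • g₁ →
      τ g₂ = (-ν) • g₂ → (∀ t ∈ T, ∃ e : ℤ, (e = 1 ∨ e = -1) ∧ τ t = e • t) → ∀ b : ℕ,
      ∃ ℓ, b < ℓ ∧ Kol ℓ ∧ (∀ t ∈ T, t ∈ A ℓ) ∧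
        (∀ i : ℕ, ((p : ℤ) ^ i) • g₁ ∈ A ℓ →
          ((p : ℤ) ^ (i + Δ ν)) • g₁ ∈ AddSubgroup.closure (T : Set V)) ∧
        (∀ i : ℕ, ((p : ℤ) ^ i) • g₂ ∈ A ℓ →
          ((p : ℤ) ^ (i + Δ (-ν))) • g₂ ∈ AddSubgroup.closure (T : Set V))) :
    ∀ j ∈ Finset.Ioc 0 K, ∀ (T : Finset V) (g₂ : V) (ν : ℤ), (ν = 1 ∨ ν = -1) →
      τ (s j) = ν • s j → τ g₂ = (-ν) • g₂ → (∀ t ∈ T, ∃ e : ℤ, (e = 1 ∨ e = -1) ∧ τ t = e • t) →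
      ∀ b : ℕ, ∃ ℓ, b < ℓ ∧ Kol ℓ ∧ (∀ t ∈ T, t ∈ A ℓ) ∧
        ∃ d₁ d₂ : ℕ, d₁ + d₂ ≤ (fun _ : ℕ ↦ Δ 1 + Δ (-1)) j ∧
        (∀ i : ℕ, ((p : ℤ) ^ i) • s j ∈ A ℓ →
          ((p : ℤ) ^ (i + d₁)) • s j ∈ AddSubgroup.closure (T : Set V)) ∧
        (∀ i : ℕ, ((p : ℤ) ^ i) • g₂ ∈ A ℓ →
          ((p : ℤ) ^ (i + d₂)) • g₂ ∈ AddSubgroup.closure (T : Set V)) := by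
  intro j _ T g₂ ν hν hτ1 hτ2 hT b
  obtain ⟨ℓ, hbℓ, hℓ, hTA, hF1, hF2⟩ := hCebΔ T (s j) g₂ ν hν hτ1 hτ2 hT b
  refine ⟨ℓ, hbℓ, hℓ, hTA, Δ ν, Δ (-ν), ?_, hF1, hF2⟩
  rcases hν with rfl | rfl
  · exact le_rfl
  · rw [neg_neg, add_comm]

/-- **File II's ledger re-derived from §2** (`Σ_{j≤K} expo s_j ≤ M₀ + K·(Δ1 + Δ(−1))`): the step-dependent
telescope is a conservative extension of `…BorelOrderTelescopeBridge.sum_expo_le_M₀_add_of_casselsTate_defect`.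
[cite: McCallumLMS1991, §1 Theorem; Thm. 5.4, Cor. 5.6] -/
theorem sum_expo_le_M₀_add_mul_of_signDefect (hp : p.Prime) (hε : ε = 1 ∨ ε = -1)
    (htor : ∀ v : V, ((p : ℤ) ^ M) • v = 0)
    (hexpo : ∀ (v : V) (a : ℕ), ((p : ℤ) ^ a) • v = 0 ↔ expo v ≤ a)
    (hKol : ∀ ℓ, Kol ℓ → ℓ.Prime) (hSel : ∀ s, s ∈ Sel ↔ ∀ v, s ∈ Loc v)
    (hxord : ((p : ℤ) ^ (M - 1)) • x ≠ 0) (hc1 : c 1 = ((p : ℤ) ^ M₀) • x)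
    (hτc : ∀ n, KolSupp Kol n → τ (c n) = (ε * (-1) ^ n.primeFactors.card) • c n)
    (hc44 : ∀ ℓ m, Kol ℓ → KolSupp Kol (ℓ * m) → ∀ a : ℕ,
      (((p : ℤ) ^ a) • c (ℓ * m) ∈ Loc (pl ℓ)) ↔ ((p : ℤ) ^ a) • c m ∈ A ℓ)
    {R : Type*} [AddCommGroup R] (P : Sel →+ Sel →+ R)
    (hCTV : ∀ ℓ m : ℕ, Kol ℓ → KolSupp Kol (ℓ * m) → ¬ ℓ ∣ m →
      ∀ (j N a b : ℕ) (t : V) (ht : t ∈ Sel) (hz : ((p : ℤ) ^ j) • c (ℓ * m) ∈ Sel),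
      ((p : ℤ) ^ N) • t = 0 → τ t = (ε * (-1) ^ (ℓ * m).primeFactors.card) • t →
      (∀ q ∈ m.primeFactors, t ∈ A q) → M - M₁ ≤ j → N + M₁ ≤ M → N ≤ j → a + b + 1 = N →
      ((p : ℤ) ^ (a + (j - N))) • c m ∉ A ℓ → ((p : ℤ) ^ b) • t ∉ A ℓ →
      P ⟨_, hz⟩ ⟨t, ht⟩ ≠ 0)
    (hCebΔ : ∀ (T : Finset V) (g₁ g₂ : V) (ν : ℤ), (ν = 1 ∨ ν = -1) → τ g₁ = ν • g₁ →
      τ g₂ = (-ν) • g₂ → (∀ t ∈ T, ∃ e : ℤ, (e = 1 ∨ e = -1) ∧ τ t = e • t) → ∀ b : ℕ,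
      ∃ ℓ, b < ℓ ∧ Kol ℓ ∧ (∀ t ∈ T, t ∈ A ℓ) ∧
        (∀ i : ℕ, ((p : ℤ) ^ i) • g₁ ∈ A ℓ →
          ((p : ℤ) ^ (i + Δ ν)) • g₁ ∈ AddSubgroup.closure (T : Set V)) ∧
        (∀ i : ℕ, ((p : ℤ) ^ i) • g₂ ∈ A ℓ →
          ((p : ℤ) ^ (i + Δ (-ν))) • g₂ ∈ AddSubgroup.closure (T : Set V)))
    (hsel : ∀ i, s i ∈ Sel)
    (hτs : ∀ i ∈ Finset.Ioc 0 K, τ (s i) = (ε * (-1) ^ i) • s i)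
    (hiso : ∀ i ∈ Finset.Ioc 0 K, ∀ i' ∈ Finset.Ioc 0 K, P ⟨s i, hsel i⟩ ⟨s i', hsel i'⟩ = 0)
    (hind : ∀ (b : ℤ) (a : ℕ → ℤ), b • x + ∑ i ∈ Finset.Ioc 0 K, a i • s i = 0 →
      b • x = 0 ∧ ∀ i ∈ Finset.Ioc 0 K, a i • s i = 0)
    (hM₁ : M₀ + K * (Δ 1 + Δ (-1)) ≤ M₁) (hroom : ∀ i ∈ Finset.Ioc 0 K, expo (s i) + M₁ ≤ M) :
    ∑ j ∈ Finset.Ioc 0 K, expo (s j) ≤ M₀ + K * (Δ 1 + Δ (-1)) := by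
  have hconst : ∑ j ∈ Finset.Ioc 0 K, (fun _ : ℕ ↦ Δ 1 + Δ (-1)) j = K * (Δ 1 + Δ (-1)) := by
    rw [Finset.sum_const, Nat.card_Ioc, smul_eq_mul, Nat.sub_zero]
  have h := sum_expo_le_M₀_add_sum_of_casselsTate_stepDefect (D := fun _ : ℕ ↦ Δ 1 + Δ (-1)) hp hε htor
    hexpo hKol hSel hxord hc1 hτc hc44 P hCTV hsel hτs hiso hind (stepDefect_of_signDefect hCebΔ)
    (by rw [hconst]; exact hM₁) hroom
  rwa [hconst] at h

end SignDefect

/-! ## §4 Two Frobenius types: protect the Kolyvagin class, pay on the lift — `D j = δ(s_j)` -/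

section TwoTypes

variable {V : Type*} [AddCommGroup V] {Pl : Type*}
variable {p M M₀ M₁ : ℕ} {ε η : ℤ} {τ : V →+ V} {Sel : AddSubgroup V} {Loc : Pl → AddSubgroup V}
  {Kol : ℕ → Prop} {pl : ℕ → Pl} {A : ℕ → AddSubgroup V} {x : V} {c : ℕ → V}
  {expo : V → ℕ} {δ : V → ℕ} {K : ℕ} {s : ℕ → V}

/-- **Per-step choice of the Frobenius type (w5 g12's observation, booked).** Let `η = ±1` be the line sign and
`δ : V → ℕ` a displayed defect function (at the Borel prime: `δ g = [𝓞-depth of g odd]`). A TYPE-ONE supplier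
(`[c₀]`-primes, Gross (3.2)) localises the step's class of sign `η` faithfully and the class of sign `−η` up to the
defect `δ`; a TYPE-TWO supplier (`[c₀ z]`-primes, `z` acting as `−1` on `W[p^M]`) does the opposite. Given BOTH,
the chain may at each step `j` take the type that sees the Kolyvagin class `c(n_{j−1})` (sign `−ν`) at full order and
put the possible defect on the lift `s_j`: this is the per-step supplier of §1 with budget **`D j = δ (s j)`**.
[cite: McCallumLMS1991, §3 Prop. 3.1, Cor. 3.2; GrossLMS1991, §3 (3.1)–(3.3)] -/
theorem stepDefect_of_twoTypes (hη : η = 1 ∨ η = -1)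
    (hCeb₁ : ∀ (T : Finset V) (g₁ g₂ : V) (ν : ℤ), (ν = 1 ∨ ν = -1) → τ g₁ = ν • g₁ →
      τ g₂ = (-ν) • g₂ → (∀ t ∈ T, ∃ e : ℤ, (e = 1 ∨ e = -1) ∧ τ t = e • t) → ∀ b : ℕ,
      ∃ ℓ, b < ℓ ∧ Kol ℓ ∧ (∀ t ∈ T, t ∈ A ℓ) ∧
        (∀ i : ℕ, ((p : ℤ) ^ i) • g₁ ∈ A ℓ →
          ((p : ℤ) ^ (i + if ν = η then 0 else δ g₁)) • g₁ ∈ AddSubgroup.closure (T : Set V)) ∧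
        (∀ i : ℕ, ((p : ℤ) ^ i) • g₂ ∈ A ℓ →
          ((p : ℤ) ^ (i + if -ν = η then 0 else δ g₂)) • g₂ ∈ AddSubgroup.closure (T : Set V)))
    (hCeb₂ : ∀ (T : Finset V) (g₁ g₂ : V) (ν : ℤ), (ν = 1 ∨ ν = -1) → τ g₁ = ν • g₁ →
      τ g₂ = (-ν) • g₂ → (∀ t ∈ T, ∃ e : ℤ, (e = 1 ∨ e = -1) ∧ τ t = e • t) → ∀ b : ℕ,
      ∃ ℓ, b < ℓ ∧ Kol ℓ ∧ (∀ t ∈ T, t ∈ A ℓ) ∧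
        (∀ i : ℕ, ((p : ℤ) ^ i) • g₁ ∈ A ℓ →
          ((p : ℤ) ^ (i + if ν = η then δ g₁ else 0)) • g₁ ∈ AddSubgroup.closure (T : Set V)) ∧
        (∀ i : ℕ, ((p : ℤ) ^ i) • g₂ ∈ A ℓ →
          ((p : ℤ) ^ (i + if -ν = η then δ g₂ else 0)) • g₂ ∈ AddSubgroup.closure (T : Set V))) :
    ∀ j ∈ Finset.Ioc 0 K, ∀ (T : Finset V) (g₂ : V) (ν : ℤ), (ν = 1 ∨ ν = -1) →
      τ (s j) = ν • s j → τ g₂ = (-ν) • g₂ → (∀ t ∈ T, ∃ e : ℤ, (e = 1 ∨ e = -1) ∧ τ t = e • t) →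
      ∀ b : ℕ, ∃ ℓ, b < ℓ ∧ Kol ℓ ∧ (∀ t ∈ T, t ∈ A ℓ) ∧
        ∃ d₁ d₂ : ℕ, d₁ + d₂ ≤ (fun j : ℕ ↦ δ (s j)) j ∧
        (∀ i : ℕ, ((p : ℤ) ^ i) • s j ∈ A ℓ →
          ((p : ℤ) ^ (i + d₁)) • s j ∈ AddSubgroup.closure (T : Set V)) ∧
        (∀ i : ℕ, ((p : ℤ) ^ i) • g₂ ∈ A ℓ →
          ((p : ℤ) ^ (i + d₂)) • g₂ ∈ AddSubgroup.closure (T : Set V)) := by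
  intro j _ T g₂ ν hν hτ1 hτ2 hT b
  by_cases hνη : ν = η
  · -- the lift has the line sign: take a TYPE-TWO prime (defect on `s_j`, none on `c(n)`)
    have hne : ¬ (-ν = η) := by
      rcases hη with h2 | h2 <;> omega
    obtain ⟨ℓ, hbℓ, hℓ, hTA, hF1, hF2⟩ := hCeb₂ T (s j) g₂ ν hν hτ1 hτ2 hT b
    refine ⟨ℓ, hbℓ, hℓ, hTA, δ (s j), 0, by simp, fun i hi ↦ ?_, fun i hi ↦ ?_⟩
    · have h := hF1 i hi
      rwa [if_pos hνη] at h
    · have h := hF2 i hi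
      rwa [if_neg hne] at h
  · -- the Kolyvagin class has the line sign: take a TYPE-ONE prime (defect on `s_j`, none on `c(n)`)
    have heq : -ν = η := by
      rcases hν with h1 | h1 <;> rcases hη with h2 | h2 <;> omega
    obtain ⟨ℓ, hbℓ, hℓ, hTA, hF1, hF2⟩ := hCeb₁ T (s j) g₂ ν hν hτ1 hτ2 hT b
    refine ⟨ℓ, hbℓ, hℓ, hTA, δ (s j), 0, by simp, fun i hi ↦ ?_, fun i hi ↦ ?_⟩
    · have h := hF1 i hi
      rwa [if_neg hνη] at h
    · have h := hF2 i hi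
      rwa [if_pos heq] at h

/-- **Kolyvagin's order telescope with both Frobenius types: `Σ_{j≤K} expo s_j ≤ M₀ + Σ_{j≤K} δ(s_j)`.** The slack
over McCallum's `M₀` is the total defect of the LIFTS (a quantity of the data `s₁,…,s_K`), not one unit per step.
[cite: McCallumLMS1991, §1 Theorem; Thm. 5.4 (proof), Cor. 5.6; Prop. 3.1, Prop. 4.7, Lemma 5.3] -/
theorem sum_expo_le_M₀_add_sum_defect_of_twoTypes (hp : p.Prime) (hε : ε = 1 ∨ ε = -1)
    (hη : η = 1 ∨ η = -1)
    (htor : ∀ v : V, ((p : ℤ) ^ M) • v = 0)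
    (hexpo : ∀ (v : V) (a : ℕ), ((p : ℤ) ^ a) • v = 0 ↔ expo v ≤ a)
    (hKol : ∀ ℓ, Kol ℓ → ℓ.Prime) (hSel : ∀ s, s ∈ Sel ↔ ∀ v, s ∈ Loc v)
    (hxord : ((p : ℤ) ^ (M - 1)) • x ≠ 0) (hc1 : c 1 = ((p : ℤ) ^ M₀) • x)
    (hτc : ∀ n, KolSupp Kol n → τ (c n) = (ε * (-1) ^ n.primeFactors.card) • c n)
    (hc44 : ∀ ℓ m, Kol ℓ → KolSupp Kol (ℓ * m) → ∀ a : ℕ,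
      (((p : ℤ) ^ a) • c (ℓ * m) ∈ Loc (pl ℓ)) ↔ ((p : ℤ) ^ a) • c m ∈ A ℓ)
    {R : Type*} [AddCommGroup R] (P : Sel →+ Sel →+ R)
    (hCTV : ∀ ℓ m : ℕ, Kol ℓ → KolSupp Kol (ℓ * m) → ¬ ℓ ∣ m →
      ∀ (j N a b : ℕ) (t : V) (ht : t ∈ Sel) (hz : ((p : ℤ) ^ j) • c (ℓ * m) ∈ Sel),
      ((p : ℤ) ^ N) • t = 0 → τ t = (ε * (-1) ^ (ℓ * m).primeFactors.card) • t →
      (∀ q ∈ m.primeFactors, t ∈ A q) → M - M₁ ≤ j → N + M₁ ≤ M → N ≤ j → a + b + 1 = N →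
      ((p : ℤ) ^ (a + (j - N))) • c m ∉ A ℓ → ((p : ℤ) ^ b) • t ∉ A ℓ →
      P ⟨_, hz⟩ ⟨t, ht⟩ ≠ 0)
    (hCeb₁ : ∀ (T : Finset V) (g₁ g₂ : V) (ν : ℤ), (ν = 1 ∨ ν = -1) → τ g₁ = ν • g₁ →
      τ g₂ = (-ν) • g₂ → (∀ t ∈ T, ∃ e : ℤ, (e = 1 ∨ e = -1) ∧ τ t = e • t) → ∀ b : ℕ,
      ∃ ℓ, b < ℓ ∧ Kol ℓ ∧ (∀ t ∈ T, t ∈ A ℓ) ∧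
        (∀ i : ℕ, ((p : ℤ) ^ i) • g₁ ∈ A ℓ →
          ((p : ℤ) ^ (i + if ν = η then 0 else δ g₁)) • g₁ ∈ AddSubgroup.closure (T : Set V)) ∧
        (∀ i : ℕ, ((p : ℤ) ^ i) • g₂ ∈ A ℓ →
          ((p : ℤ) ^ (i + if -ν = η then 0 else δ g₂)) • g₂ ∈ AddSubgroup.closure (T : Set V)))
    (hCeb₂ : ∀ (T : Finset V) (g₁ g₂ : V) (ν : ℤ), (ν = 1 ∨ ν = -1) → τ g₁ = ν • g₁ →
      τ g₂ = (-ν) • g₂ → (∀ t ∈ T, ∃ e : ℤ, (e = 1 ∨ e = -1) ∧ τ t = e • t) → ∀ b : ℕ,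
      ∃ ℓ, b < ℓ ∧ Kol ℓ ∧ (∀ t ∈ T, t ∈ A ℓ) ∧
        (∀ i : ℕ, ((p : ℤ) ^ i) • g₁ ∈ A ℓ →
          ((p : ℤ) ^ (i + if ν = η then δ g₁ else 0)) • g₁ ∈ AddSubgroup.closure (T : Set V)) ∧
        (∀ i : ℕ, ((p : ℤ) ^ i) • g₂ ∈ A ℓ →
          ((p : ℤ) ^ (i + if -ν = η then δ g₂ else 0)) • g₂ ∈ AddSubgroup.closure (T : Set V)))
    (hsel : ∀ i, s i ∈ Sel)
    (hτs : ∀ i ∈ Finset.Ioc 0 K, τ (s i) = (ε * (-1) ^ i) • s i)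
    (hiso : ∀ i ∈ Finset.Ioc 0 K, ∀ i' ∈ Finset.Ioc 0 K, P ⟨s i, hsel i⟩ ⟨s i', hsel i'⟩ = 0)
    (hind : ∀ (b : ℤ) (a : ℕ → ℤ), b • x + ∑ i ∈ Finset.Ioc 0 K, a i • s i = 0 →
      b • x = 0 ∧ ∀ i ∈ Finset.Ioc 0 K, a i • s i = 0)
    (hM₁ : M₀ + ∑ j ∈ Finset.Ioc 0 K, δ (s j) ≤ M₁) (hroom : ∀ i ∈ Finset.Ioc 0 K, expo (s i) + M₁ ≤ M) :
    ∑ j ∈ Finset.Ioc 0 K, expo (s j) ≤ M₀ + ∑ j ∈ Finset.Ioc 0 K, δ (s j) :=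
  sum_expo_le_M₀_add_sum_of_casselsTate_stepDefect (D := fun j : ℕ ↦ δ (s j)) hp hε htor hexpo hKol hSel
    hxord hc1 hτc hc44 P hCTV hsel hτs hiso hind (stepDefect_of_twoTypes hη hCeb₁ hCeb₂) hM₁ hroom

end TwoTypes

/-! ## §5 The two-type ledger in the `𝓞`-depth currency: `Σ ⌈dp sⱼ/2⌉ ≤ M₀ + #{j : dp sⱼ odd}` -/

section Depth

variable {V : Type*} [AddCommGroup V] {Pl : Type*}
variable {p M M₀ M₁ : ℕ} {ε η : ℤ} {τ : V →+ V} {Sel : AddSubgroup V} {Loc : Pl → AddSubgroup V}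
  {Kol : ℕ → Prop} {pl : ℕ → Pl} {A : ℕ → AddSubgroup V} {x : V} {c : ℕ → V}
  {dp : V → ℕ} {K : ℕ} {s : ℕ → V}

omit [AddCommGroup V] in
/-- The total depth-parity defect of the lifts is the number of odd-depth lifts. [folklore] -/
theorem sum_mod_two_eq_card_filter_odd (dp : V → ℕ) (s : ℕ → V) (K : ℕ) :
    ∑ j ∈ Finset.Ioc 0 K, dp (s j) % 2 = ((Finset.Ioc 0 K).filter fun j ↦ Odd (dp (s j))).card := by
  rw [Finset.card_filter]
  refine Finset.sum_congr rfl fun j _ ↦ ?_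
  by_cases h : Odd (dp (s j))
  · rw [if_pos h, Nat.odd_iff.mp h]
  · rw [if_neg h, Nat.not_odd_iff.mp h]

/-- **The order telescope with both Frobenius types, depth currency: `Σ_{j≤K} ⌈dp s_j/2⌉ ≤ M₀ + #{j : dp s_j odd}`**
(`p^a v = 0 ↔ dp v ≤ 2a`, `ord v = p^{⌈dp v/2⌉}`; the type-one supplier grants a class of sign `−η` local order
`ord / p^{dp mod 2}`, the type-two supplier does so for sign `η` — the request shapes FILE 7′
`…BorelRequestsCebotarev` delivers at type one and its sign-swapped twin at type two). Reading at the Borel prime of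
a twisted member: `ord_p #Ш(W/K″)[p^∞] ≤ 2M₀ + 2·#{odd-depth lifts}`.
[cite: McCallumLMS1991, §1 Theorem; Thm. 5.4, Cor. 5.6] -/
theorem sum_half_succ_dp_le_M₀_add_card_odd_of_twoTypes (hp : p.Prime) (hε : ε = 1 ∨ ε = -1)
    (hη : η = 1 ∨ η = -1)
    (htor : ∀ v : V, ((p : ℤ) ^ M) • v = 0)
    (hdp : ∀ (v : V) (a : ℕ), ((p : ℤ) ^ a) • v = 0 ↔ dp v ≤ 2 * a)
    (hKol : ∀ ℓ, Kol ℓ → ℓ.Prime) (hSel : ∀ s, s ∈ Sel ↔ ∀ v, s ∈ Loc v)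
    (hxord : ((p : ℤ) ^ (M - 1)) • x ≠ 0) (hc1 : c 1 = ((p : ℤ) ^ M₀) • x)
    (hτc : ∀ n, KolSupp Kol n → τ (c n) = (ε * (-1) ^ n.primeFactors.card) • c n)
    (hc44 : ∀ ℓ m, Kol ℓ → KolSupp Kol (ℓ * m) → ∀ a : ℕ,
      (((p : ℤ) ^ a) • c (ℓ * m) ∈ Loc (pl ℓ)) ↔ ((p : ℤ) ^ a) • c m ∈ A ℓ)
    {R : Type*} [AddCommGroup R] (P : Sel →+ Sel →+ R)
    (hCTV : ∀ ℓ m : ℕ, Kol ℓ → KolSupp Kol (ℓ * m) → ¬ ℓ ∣ m →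
      ∀ (j N a b : ℕ) (t : V) (ht : t ∈ Sel) (hz : ((p : ℤ) ^ j) • c (ℓ * m) ∈ Sel),
      ((p : ℤ) ^ N) • t = 0 → τ t = (ε * (-1) ^ (ℓ * m).primeFactors.card) • t →
      (∀ q ∈ m.primeFactors, t ∈ A q) → M - M₁ ≤ j → N + M₁ ≤ M → N ≤ j → a + b + 1 = N →
      ((p : ℤ) ^ (a + (j - N))) • c m ∉ A ℓ → ((p : ℤ) ^ b) • t ∉ A ℓ →
      P ⟨_, hz⟩ ⟨t, ht⟩ ≠ 0)
    (hCeb₁ : ∀ (T : Finset V) (g₁ g₂ : V) (ν : ℤ), (ν = 1 ∨ ν = -1) → τ g₁ = ν • g₁ →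
      τ g₂ = (-ν) • g₂ → (∀ t ∈ T, ∃ e : ℤ, (e = 1 ∨ e = -1) ∧ τ t = e • t) → ∀ b : ℕ,
      ∃ ℓ, b < ℓ ∧ Kol ℓ ∧ (∀ t ∈ T, t ∈ A ℓ) ∧
        (∀ i : ℕ, ((p : ℤ) ^ i) • g₁ ∈ A ℓ →
          ((p : ℤ) ^ (i + if ν = η then 0 else dp g₁ % 2)) • g₁ ∈ AddSubgroup.closure (T : Set V)) ∧
        (∀ i : ℕ, ((p : ℤ) ^ i) • g₂ ∈ A ℓ →
          ((p : ℤ) ^ (i + if -ν = η then 0 else dp g₂ % 2)) • g₂ ∈ AddSubgroup.closure (T : Set V)))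
    (hCeb₂ : ∀ (T : Finset V) (g₁ g₂ : V) (ν : ℤ), (ν = 1 ∨ ν = -1) → τ g₁ = ν • g₁ →
      τ g₂ = (-ν) • g₂ → (∀ t ∈ T, ∃ e : ℤ, (e = 1 ∨ e = -1) ∧ τ t = e • t) → ∀ b : ℕ,
      ∃ ℓ, b < ℓ ∧ Kol ℓ ∧ (∀ t ∈ T, t ∈ A ℓ) ∧
        (∀ i : ℕ, ((p : ℤ) ^ i) • g₁ ∈ A ℓ →
          ((p : ℤ) ^ (i + if ν = η then dp g₁ % 2 else 0)) • g₁ ∈ AddSubgroup.closure (T : Set V)) ∧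
        (∀ i : ℕ, ((p : ℤ) ^ i) • g₂ ∈ A ℓ →
          ((p : ℤ) ^ (i + if -ν = η then dp g₂ % 2 else 0)) • g₂ ∈ AddSubgroup.closure (T : Set V)))
    (hsel : ∀ i, s i ∈ Sel)
    (hτs : ∀ i ∈ Finset.Ioc 0 K, τ (s i) = (ε * (-1) ^ i) • s i)
    (hiso : ∀ i ∈ Finset.Ioc 0 K, ∀ i' ∈ Finset.Ioc 0 K, P ⟨s i, hsel i⟩ ⟨s i', hsel i'⟩ = 0)
    (hind : ∀ (b : ℤ) (a : ℕ → ℤ), b • x + ∑ i ∈ Finset.Ioc 0 K, a i • s i = 0 →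
      b • x = 0 ∧ ∀ i ∈ Finset.Ioc 0 K, a i • s i = 0)
    (hM₁ : M₀ + ((Finset.Ioc 0 K).filter fun j ↦ Odd (dp (s j))).card ≤ M₁)
    (hroom : ∀ i ∈ Finset.Ioc 0 K, (dp (s i) + 1) / 2 + M₁ ≤ M) :
    ∑ j ∈ Finset.Ioc 0 K, (dp (s j) + 1) / 2 ≤
      M₀ + ((Finset.Ioc 0 K).filter fun j ↦ Odd (dp (s j))).card := by
  rw [← sum_mod_two_eq_card_filter_odd] at hM₁ ⊢
  exact sum_expo_le_M₀_add_sum_defect_of_twoTypes (expo := fun v ↦ (dp v + 1) / 2) (δ := fun v ↦ dp v % 2)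
    hp hε hη htor (pow_zsmul_eq_zero_iff_half_succ_le hdp) hKol hSel hxord hc1 hτc hc44 P hCTV hCeb₁ hCeb₂
    hsel hτs hiso hind hM₁ hroom

/-- **Even-depth lifts give McCallum's inequality verbatim: `Σ_{j≤K} ⌈dp s_j/2⌉ ≤ M₀`** (both types available,
every lift `s_j` of even `𝓞`-depth). For the lifts of the generators of a maximal isotropic `⊕ Dⱼ` of `Ш_{p^∞}`
this is `#Ш_{p^∞} ≤ p^{2M₀}` (Cor. 5.6). [cite: McCallumLMS1991, §1 Theorem; Thm. 5.4, Cor. 5.6] -/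
theorem sum_half_succ_dp_le_M₀_of_twoTypes_of_even (hp : p.Prime) (hε : ε = 1 ∨ ε = -1)
    (hη : η = 1 ∨ η = -1)
    (htor : ∀ v : V, ((p : ℤ) ^ M) • v = 0)
    (hdp : ∀ (v : V) (a : ℕ), ((p : ℤ) ^ a) • v = 0 ↔ dp v ≤ 2 * a)
    (hKol : ∀ ℓ, Kol ℓ → ℓ.Prime) (hSel : ∀ s, s ∈ Sel ↔ ∀ v, s ∈ Loc v)
    (hxord : ((p : ℤ) ^ (M - 1)) • x ≠ 0) (hc1 : c 1 = ((p : ℤ) ^ M₀) • x)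
    (hτc : ∀ n, KolSupp Kol n → τ (c n) = (ε * (-1) ^ n.primeFactors.card) • c n)
    (hc44 : ∀ ℓ m, Kol ℓ → KolSupp Kol (ℓ * m) → ∀ a : ℕ,
      (((p : ℤ) ^ a) • c (ℓ * m) ∈ Loc (pl ℓ)) ↔ ((p : ℤ) ^ a) • c m ∈ A ℓ)
    {R : Type*} [AddCommGroup R] (P : Sel →+ Sel →+ R)
    (hCTV : ∀ ℓ m : ℕ, Kol ℓ → KolSupp Kol (ℓ * m) → ¬ ℓ ∣ m →
      ∀ (j N a b : ℕ) (t : V) (ht : t ∈ Sel) (hz : ((p : ℤ) ^ j) • c (ℓ * m) ∈ Sel),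
      ((p : ℤ) ^ N) • t = 0 → τ t = (ε * (-1) ^ (ℓ * m).primeFactors.card) • t →
      (∀ q ∈ m.primeFactors, t ∈ A q) → M - M₁ ≤ j → N + M₁ ≤ M → N ≤ j → a + b + 1 = N →
      ((p : ℤ) ^ (a + (j - N))) • c m ∉ A ℓ → ((p : ℤ) ^ b) • t ∉ A ℓ →
      P ⟨_, hz⟩ ⟨t, ht⟩ ≠ 0)
    (hCeb₁ : ∀ (T : Finset V) (g₁ g₂ : V) (ν : ℤ), (ν = 1 ∨ ν = -1) → τ g₁ = ν • g₁ →
      τ g₂ = (-ν) • g₂ → (∀ t ∈ T, ∃ e : ℤ, (e = 1 ∨ e = -1) ∧ τ t = e • t) → ∀ b : ℕ,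
      ∃ ℓ, b < ℓ ∧ Kol ℓ ∧ (∀ t ∈ T, t ∈ A ℓ) ∧
        (∀ i : ℕ, ((p : ℤ) ^ i) • g₁ ∈ A ℓ →
          ((p : ℤ) ^ (i + if ν = η then 0 else dp g₁ % 2)) • g₁ ∈ AddSubgroup.closure (T : Set V)) ∧
        (∀ i : ℕ, ((p : ℤ) ^ i) • g₂ ∈ A ℓ →
          ((p : ℤ) ^ (i + if -ν = η then 0 else dp g₂ % 2)) • g₂ ∈ AddSubgroup.closure (T : Set V)))
    (hCeb₂ : ∀ (T : Finset V) (g₁ g₂ : V) (ν : ℤ), (ν = 1 ∨ ν = -1) → τ g₁ = ν • g₁ →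
      τ g₂ = (-ν) • g₂ → (∀ t ∈ T, ∃ e : ℤ, (e = 1 ∨ e = -1) ∧ τ t = e • t) → ∀ b : ℕ,
      ∃ ℓ, b < ℓ ∧ Kol ℓ ∧ (∀ t ∈ T, t ∈ A ℓ) ∧
        (∀ i : ℕ, ((p : ℤ) ^ i) • g₁ ∈ A ℓ →
          ((p : ℤ) ^ (i + if ν = η then dp g₁ % 2 else 0)) • g₁ ∈ AddSubgroup.closure (T : Set V)) ∧
        (∀ i : ℕ, ((p : ℤ) ^ i) • g₂ ∈ A ℓ →
          ((p : ℤ) ^ (i + if -ν = η then dp g₂ % 2 else 0)) • g₂ ∈ AddSubgroup.closure (T : Set V)))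
    (hsel : ∀ i, s i ∈ Sel)
    (hτs : ∀ i ∈ Finset.Ioc 0 K, τ (s i) = (ε * (-1) ^ i) • s i)
    (hiso : ∀ i ∈ Finset.Ioc 0 K, ∀ i' ∈ Finset.Ioc 0 K, P ⟨s i, hsel i⟩ ⟨s i', hsel i'⟩ = 0)
    (hind : ∀ (b : ℤ) (a : ℕ → ℤ), b • x + ∑ i ∈ Finset.Ioc 0 K, a i • s i = 0 →
      b • x = 0 ∧ ∀ i ∈ Finset.Ioc 0 K, a i • s i = 0)
    (heven : ∀ i ∈ Finset.Ioc 0 K, Even (dp (s i)))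
    (hM₁ : M₀ ≤ M₁) (hroom : ∀ i ∈ Finset.Ioc 0 K, (dp (s i) + 1) / 2 + M₁ ≤ M) :
    ∑ j ∈ Finset.Ioc 0 K, (dp (s j) + 1) / 2 ≤ M₀ := by
  have h0 : ((Finset.Ioc 0 K).filter fun j ↦ Odd (dp (s j))).card = 0 := by
    rw [Finset.card_eq_zero, Finset.filter_eq_empty_iff]
    exact fun j hj ↦ Nat.not_odd_iff_even.mpr (heven j hj)
  have h := sum_half_succ_dp_le_M₀_add_card_odd_of_twoTypes hp hε hη htor hdp hKol hSel hxord hc1 hτc hc44 P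
    hCTV hCeb₁ hCeb₂ hsel hτs hiso hind (by rw [h0]; exact hM₁) hroom
  rwa [h0, add_zero] at h

end Depth

end Summit.BirchSwinnertonDyer.BirchSwinnertonDyer.Theorems.PrintCFram.BorelDescent

end
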